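import Mathlib
import Summits.CriticalPhenomena.CardyFormulaZ2.Theses.CardyMagicRigidity
import Summits.CriticalPhenomena.CardyFormulaZ2.Theorems.CardyMagicRigidityHexSegmentDefs
import Summits.CriticalPhenomena.CardyFormulaZ2.Theorems.CardyMagicRigidityNestingRigidityTransferGluing
import Literature.Probability.Percolation.FullPlaneCNL
import Literature.Probability.Percolation.FullPlaneCNLPresentation
import Literature.Probability.Percolation.LoopRepresentationProofs
import Literature.Probability.RandomPlanarGeometry.LoopConfigurationsMetric
import HarnessLib

/-!
# Line `Sketch` (two-leg Chayes–Lei chain) for crux `LoopLimitZ2EqT` (stmt-CriticalPhenomena-4833):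
# the sorry-free composition

Route `CardyMagicRigidity`, sub-problem `CriticalPhenomena/CardyFormulaZ2`. With the vocabulary of
`Theorems/CardyMagicRigidityHexSegmentDefs.lean` (skeleton `Cruxes/LoopLimitZ2EqT/Lines/Sketch.lean`),
this file proves the registered sub-goal `loopLimitZ2EqT_of_stubs`: the five loop-level statements
`BondEndLaw` (S1, landed), `SiteEndLoops` (S2), `CoinMeasurable` (S3, landed), `TriToSquareLoops` (S4)
and `SegmentLoops` (conclusion of S5 ⇒ S6 ⇒ S7) imply the crux
`Summit.CriticalPhenomena.CardyFormulaZ2.Theses.CardyMagicRigidity.LoopLimitZ2EqT`.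

Proof: `d_CN(ℤ², 𝕋) ≤ d_CN(ℤ², M₁) + d_CN(M₁, M₀) + d_CN(M₀, 𝕋)` by two applications of the gluing
inequality `LoopConfig.cnLawEDist_triangle` (outer pairs (bond-ℤ², site-𝕋) — measurable exceptional
event `measurableSet_isClose_bond_site` — and (M₁, site-𝕋) — `measurableSet_isClose_seg_site` from S3;
all sample spaces standard Borel), and `d_CN(ℤ², M₁) ≤ d_CN(ℤ², bond-𝕋̃)` by re-presenting the second
law along `cfg` (`cnLawEDist_comp_snd_le`, measurability from S3) and the law identity S1; the three
right-hand terms tend to `0` by S4, S7, S2, and `d_CN ≥ 0` squeezes.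
-/

noncomputable section

open MeasureTheory Set Filter Metric
open scoped Real Topology ENNReal BigOperators

namespace Summit.CriticalPhenomena.CardyFormulaZ2.Cruxes.LoopLimitZ2EqT.HexSegment

open Literature.Probability.RandomPlanarGeometry Literature.Probability.Percolation
  Literature.Probability.LatticeModels
open _root_.Summit.CriticalPhenomena.CardyFormulaZ2.Theses.CardyMagicRigidity (LoopLimitZ2EqT)
open _root_.Summit.CriticalPhenomena.CardyFormulaZ2.Cruxes.NestingRigidity.RingCloudTomography
  (measurableSet_isClose_bond_site)

/-- **The two-leg Chayes–Lei chain reduces the crux to five loop-level statements** (registered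
sub-goal `loopLimitZ2EqT_of_stubs` of line `Sketch`): the endpoint law identity `BondEndLaw` (S1), the
arena identity in `d_CN` `SiteEndLoops` (S2), measurability of the coin maps `CoinMeasurable` (S3), the
isoradial transport bond-`ℤ²` ~ bond-`𝕋̃` `TriToSquareLoops` (S4) and loop-level segment flatness
`SegmentLoops` (S7's conclusion) together imply `LoopLimitZ2EqT`:
`d_CN(ℤ², 𝕋) ≤ d_CN(ℤ², bond-𝕋̃) + d_CN(M₁, M₀) + d_CN(M₀, 𝕋) → 0`. -/
theorem loopLimitZ2EqT_of_stubs :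
    BondEndLaw → SiteEndLoops → CoinMeasurable → TriToSquareLoops → SegmentLoops → LoopLimitZ2EqT := by
  intro h1 h2 h3 h4 h7
  haveI := standardBorelSpace_bondConfig
  haveI := standardBorelSpace_siteConfig
  haveI := standardBorelSpace_coin
  show Tendsto (fun δ : ℝ ↦ LoopConfig.cnLawEDist (bondPercolation (zdGraph 2) half)
    (bondLoopConfig δ 0) (triSitePercolation half) (siteLoopConfig δ)) (𝓝[>] 0) (𝓝 0)
  set μZ : Measure (BondConfig (Site 2)) := bondPercolation (zdGraph 2) half with hμZ
  set μB : Measure (BondConfig (Site 2)) := bondPercolation triGraph (criticalWeightI (Real.pi / 6))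
    with hμB
  set μT : Measure (SiteConfig (Site 2)) := triSitePercolation half with hμT
  set ν₁ : Measure (Set Coin) := prodBernoulli (prm 1) with hν₁
  set ν₀ : Measure (Set Coin) := prodBernoulli (prm 0) with hν₀
  have hle : ∀ δ : ℝ,
      LoopConfig.cnLawEDist μZ (bondLoopConfig δ 0) μT (siteLoopConfig δ) ≤
        LoopConfig.cnLawEDist μZ (bondLoopConfig δ 0) μB (triBondLoops δ) +
          (LoopConfig.cnLawEDist ν₁ (segLoops δ) ν₀ (segLoops δ) +
            LoopConfig.cnLawEDist ν₀ (segLoops δ) μT (siteLoopConfig δ)) := by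
    intro δ
    have step₁ : LoopConfig.cnLawEDist μZ (bondLoopConfig δ 0) μT (siteLoopConfig δ) ≤
        LoopConfig.cnLawEDist μZ (bondLoopConfig δ 0) ν₁ (segLoops δ) +
          LoopConfig.cnLawEDist ν₁ (segLoops δ) μT (siteLoopConfig δ) :=
      LoopConfig.cnLawEDist_triangle μZ ν₁ μT (bondLoopConfig δ 0) (segLoops δ) (siteLoopConfig δ)
        (measurableSet_isClose_bond_site δ δ)
    have step₂ : LoopConfig.cnLawEDist μZ (bondLoopConfig δ 0) ν₁ (segLoops δ) ≤
        LoopConfig.cnLawEDist μZ (bondLoopConfig δ 0) μB (triBondLoops δ) := by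
      calc LoopConfig.cnLawEDist μZ (bondLoopConfig δ 0) ν₁ (segLoops δ)
          = LoopConfig.cnLawEDist μZ (bondLoopConfig δ 0) ν₁ (triBondLoops δ ∘ cfg) := rfl
        _ ≤ LoopConfig.cnLawEDist μZ (bondLoopConfig δ 0) (ν₁.map cfg) (triBondLoops δ) :=
          cnLawEDist_comp_snd_le μZ (bondLoopConfig δ 0) ν₁ h3.1 (triBondLoops δ)
        _ = LoopConfig.cnLawEDist μZ (bondLoopConfig δ 0) μB (triBondLoops δ) := by
          rw [hν₁, hμB, ← h1]
    have step₃ : LoopConfig.cnLawEDist ν₁ (segLoops δ) μT (siteLoopConfig δ) ≤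
        LoopConfig.cnLawEDist ν₁ (segLoops δ) ν₀ (segLoops δ) +
          LoopConfig.cnLawEDist ν₀ (segLoops δ) μT (siteLoopConfig δ) :=
      LoopConfig.cnLawEDist_triangle ν₁ ν₀ μT (segLoops δ) (segLoops δ) (siteLoopConfig δ)
        (measurableSet_isClose_seg_site h3 δ δ)
    calc LoopConfig.cnLawEDist μZ (bondLoopConfig δ 0) μT (siteLoopConfig δ)
        ≤ LoopConfig.cnLawEDist μZ (bondLoopConfig δ 0) ν₁ (segLoops δ) +
          LoopConfig.cnLawEDist ν₁ (segLoops δ) μT (siteLoopConfig δ) := step₁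
      _ ≤ _ := add_le_add step₂ step₃
  have hlim : Tendsto (fun δ : ℝ ↦
      LoopConfig.cnLawEDist μZ (bondLoopConfig δ 0) μB (triBondLoops δ) +
        (LoopConfig.cnLawEDist ν₁ (segLoops δ) ν₀ (segLoops δ) +
          LoopConfig.cnLawEDist ν₀ (segLoops δ) μT (siteLoopConfig δ))) (𝓝[>] 0) (𝓝 0) := by
    have key := h4.add (h7.add h2)
    simpa only [add_zero] using key
  exact tendsto_of_tendsto_of_tendsto_of_le_of_le tendsto_const_nhds hlim (fun _ ↦ bot_le) hle

end Summit.CriticalPhenomena.CardyFormulaZ2.Cruxes.LoopLimitZ2EqT.HexSegment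

end
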